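import Mathlib
import Summits.KontsevichZagierPeriods.KontsevichZagierPeriods.Theorems.SoloInformedLegendreKernel
import Literature.NumberTheory.Transcendental.KZCalculus
import Literature.NumberTheory.Transcendental.KontsevichZagierGammaProofs
import Literature.NumberTheory.Transcendental.OnePeriodsMasserCMProofs
import HarnessLib
import HarnessLib.Audit

/-!
# SoloInformed — Legendre relation XV: Weierstrass tools (Chudnovsky's CM corollary; `Ω₀ = 2K`)

Solo-informed residency (s33), file XV of the Legendre chain: the two general tools behind
THEOREM XXII (file XVI), both assembled from PROVED tree theorems.

(1) **Chudnovsky's CM corollary** (`soloInformed_algebraicIndependent_pi_of_hasCM`; Chudnovsky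
1984, Ch. 7, Cor. 2.3): if `Λ` has algebraic invariants `g₂, g₃` and complex multiplication and
`ω₁ ∈ ℚ(π, x)`, then `π, x` are algebraically independent over `ℚ`. Masser's CM quasi-period
relation (`MasserCM.cm_quasiPeriod_relation`: `A η₁ω₁ − s ω₁² = K·2πi`, `A, s, K ∈ ℚ̄`, `A ≠ 0`)
puts `η₁ω₁` in the algebraic closure of `ℚ(π, ω₁)`, and Chudnovsky's Theorem 7.2.6
(`Chudnovsky.Chudnovsky1984_thm_7_2_6_holds`: `π/ω₁, η₁/ω₁` algebraically independent) gives
`trdeg ℚ(π, x) ≥ 2`.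

(2) **The real period in Legendre form** (`soloInformed_minRealPeriod_div_two_eq_of_roots`): for a
real lattice whose cubic factors as `4(x−a)(x−b)(x−c)`, `c < b < a`, `a − c = 1`, the least positive
real period is `Ω₀ = 2K(k)`, `k² = b − c`:  `Ω₀/2 = ∫₀¹ ds/√((1−s²)(1−(b−c)s²))` — the tree's
real-period formula `Ω₀/2 = ∫_{e₁}^∞ dx/√f` (`PeriodPair.IsReal.integral_Ioi_inv_sqrt_cubic_eq`),
the identification `e₁ = a` (largest root: `f(e₁) = 0`, `f > 0` on `(e₁,∞)`), and the substitution
`x = c + s⁻²`. Also: the value of a one-dimensional representation on `(0,1)` as an interval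
integral (`soloInformed_value_eq_integral_Ioo`).

References: G. V. Chudnovsky, *Contributions to the theory of transcendental numbers*, AMS
Math. Surveys 19 (1984), Ch. 7, Thm 2.6 and Cor. 2.3 (pp. 307–309); D. Masser, *Elliptic functions
and transcendence*, LNM 437 (1975), Ch. III; D. F. Lawden, *Elliptic functions and applications*
(1989) §§ 6.10–6.11; Whittaker–Watson § 22.42; this work (s33).
-/

noncomputable section

open MeasureTheory Set Filter
open scoped Classical ComplexConjugate

open Literature.NumberTheory.Transcendental Literature.NumberTheory.Transcendental.KZ
open Literature.ModelTheory.ExponentialFields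

namespace Summit.KontsevichZagierPeriods.KontsevichZagierPeriods.Theorems

/-! ### Chudnovsky's Corollary 7.2.3: CM periods -/

/-- **Chudnovsky's CM corollary** (Chudnovsky 1984, Ch. 7, Cor. 2.3). If `Λ = ℤω₁ + ℤω₂` has
algebraic invariants `g₂, g₃` and complex multiplication, and `ω₁ ∈ ℚ(π, x)`, then `π` and `x`
are algebraically independent over `ℚ`. Proof: Masser's CM relation `A η₁ω₁ − s ω₁² = K·2πi`
(`A, s, K ∈ ℚ̄`, `A ≠ 0`) makes `η₁ω₁`, hence `π/ω₁` and `η₁/ω₁ = η₁ω₁/ω₁²`, algebraic over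
`F = ℚ(π, x)`; they are algebraically independent by Chudnovsky's Theorem 7.2.6, so
`trdeg_ℚ F ≥ 2` and the two generators `π, x` are independent.
[cite: Chudnovsky1984, Ch. 7 Cor. 2.3 (p. 308)] -/
theorem soloInformed_algebraicIndependent_pi_of_hasCM {L : PeriodPair}
    (hg₂ : IsAlgebraic ℚ L.g₂) (hg₃ : IsAlgebraic ℚ L.g₃) (hCM : L.HasCM) (x : ℂ)
    (hω : L.ω₁ ∈ IntermediateField.adjoin ℚ ({(Real.pi : ℂ), x} : Set ℂ)) :
    AlgebraicIndependent ℚ ![(Real.pi : ℂ), x] := by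
  have hind : AlgebraicIndependent ℚ ![(Real.pi : ℂ) / L.ω₁, L.η₁ / L.ω₁] :=
    Chudnovsky.Chudnovsky1984_thm_7_2_6_holds L hg₂ hg₃
  obtain ⟨A₀, s, K₀, hA₀, hs, hK₀, hA0, -, hrel⟩ :=
    MasserCM.cm_quasiPeriod_relation L hg₂ hg₃ hCM
  -- the field `F = ℚ(π, x)` and its relative algebraic closure `A` in `ℂ`
  set F : IntermediateField ℚ ℂ := IntermediateField.adjoin ℚ ({(Real.pi : ℂ), x} : Set ℂ)
    with hF
  set A : IntermediateField F ℂ := algebraicClosure F ℂ with hA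
  have hFA : ∀ y : ℂ, y ∈ F → y ∈ A := fun y hy ↦ by simpa using A.algebraMap_mem ⟨y, hy⟩
  have hQA : ∀ y : ℂ, IsAlgebraic ℚ y → y ∈ A := fun y hy ↦
    mem_algebraicClosure_iff.mpr (hy.tower_top F)
  have hπF : (Real.pi : ℂ) ∈ F := IntermediateField.subset_adjoin ℚ _ (by simp)
  have hω0 : L.ω₁ ≠ 0 := L.ω₁_ne_zero
  have hω₁A : L.ω₁ ∈ A := hFA _ hω
  have hIA : Complex.I ∈ A :=
    hQA _ ⟨Polynomial.X ^ 2 + Polynomial.C 1,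
      (Polynomial.monic_X_pow_add_C (1 : ℚ) two_ne_zero).ne_zero, by simp⟩
  have h2A : (2 : ℂ) ∈ A := by exact_mod_cast A.natCast_mem 2
  have hηωA : L.η₁ * L.ω₁ ∈ A := by
    have : L.η₁ * L.ω₁ = (K₀ * (2 * Real.pi * Complex.I) + s * L.ω₁ ^ 2) / A₀ := by
      rw [eq_div_iff hA0]
      linear_combination hrel
    rw [this]
    exact div_mem (add_mem (mul_mem (hQA _ hK₀) (mul_mem (mul_mem h2A (hFA _ hπF)) hIA))
      (mul_mem (hQA _ hs) (pow_mem hω₁A 2))) (hQA _ hA₀)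
  have huA : (Real.pi : ℂ) / L.ω₁ ∈ A := div_mem (hFA _ hπF) hω₁A
  have hvA : L.η₁ / L.ω₁ ∈ A := by
    have : L.η₁ / L.ω₁ = L.η₁ * L.ω₁ / L.ω₁ ^ 2 := by field_simp
    rw [this]
    exact div_mem hηωA (pow_mem hω₁A 2)
  -- `E = F(π/ω₁, η₁/ω₁)` is algebraic over `F` and contains an algebraically independent pair
  set T : Set ℂ := {(Real.pi : ℂ) / L.ω₁, L.η₁ / L.ω₁} with hT
  have hTalg : ∀ t ∈ T, IsAlgebraic F t := by
    rintro t (rfl | rfl)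
    · exact mem_algebraicClosure_iff.mp huA
    · exact mem_algebraicClosure_iff.mp hvA
  let E : IntermediateField F ℂ := IntermediateField.adjoin F T
  haveI : Algebra.IsAlgebraic F E :=
    IntermediateField.isAlgebraic_adjoin fun t ht ↦ (hTalg t ht).isIntegral
  haveI : FaithfulSMul ℚ F :=
    (faithfulSMul_iff_algebraMap_injective ℚ F).mpr (algebraMap ℚ F).injective
  haveI : FaithfulSMul F E :=
    (faithfulSMul_iff_algebraMap_injective F E).mpr (algebraMap F E).injective
  have hE : Algebra.trdeg ℚ E = Algebra.trdeg ℚ F := by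
    rw [← trdeg_add_eq ℚ F (A := E), trdeg_eq_zero (R := F) (A := E),
      add_zero]
  have hu : (Real.pi : ℂ) / L.ω₁ ∈ E := IntermediateField.subset_adjoin F T (by simp [hT])
  have hv : L.η₁ / L.ω₁ ∈ E := IntermediateField.subset_adjoin F T (by simp [hT])
  let g : Fin 2 → E := ![⟨_, hu⟩, ⟨_, hv⟩]
  have hg : AlgebraicIndependent ℚ g := by
    refine AlgebraicIndependent.of_comp (IsScalarTower.toAlgHom ℚ E ℂ) ?_
    convert hind using 1
    ext i
    fin_cases i <;> rfl
  have h2 : (2 : Cardinal) ≤ Algebra.trdeg ℚ F := by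
    calc (2 : Cardinal) = Cardinal.mk (Fin 2) := by simp
      _ ≤ Algebra.trdeg ℚ E := hg.cardinalMk_le_trdeg
      _ = Algebra.trdeg ℚ F := hE
  refine Literature.Barriers.Schanuel.algebraicIndependent_of_le_trdeg_adjoin _ ?_
  rw [Matrix.range_cons_cons_empty]
  exact_mod_cast h2

/-! ### One-dimensional representations on `(0,1)` as interval integrals -/

/-- The value of a one-dimensional representation on `{x | x 0 ∈ (0,1)}` with integrand `g(x 0)`
is `∫_{(0,1)} g` (`MeasurableEquiv.funUnique`, volume preserving). [folklore] -/
theorem soloInformed_value_eq_integral_Ioo (R : IntegralRep 1) (g : ℝ → ℝ)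
    (hRd : R.domain = {x : Fin 1 → ℝ | x 0 ∈ Ioo (0:ℝ) 1})
    (hRi : EqOn R.integrand (fun x => g (x 0)) R.domain) :
    R.value = ∫ t in Ioo (0:ℝ) 1, g t := by
  have hmp : MeasurePreserving (MeasurableEquiv.funUnique (Fin 1) ℝ) volume volume :=
    volume_preserving_funUnique (Fin 1) ℝ
  have hmeas : MeasurableSet R.domain := by
    rw [hRd]; exact (measurable_pi_apply 0) measurableSet_Ioo
  have hset : R.domain = (MeasurableEquiv.funUnique (Fin 1) ℝ) ⁻¹' Ioo 0 1 := by
    rw [hRd]; ext z; simp [MeasurableEquiv.funUnique, Fin.default_eq_zero]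
  unfold IntegralRep.value
  rw [setIntegral_congr_fun hmeas hRi, hset, ← hmp.setIntegral_preimage_emb
    (MeasurableEquiv.funUnique (Fin 1) ℝ).measurableEmbedding g (Ioo 0 1)]
  rfl

/-! ### The real period of a real cubic with three ordered real roots, normalised `e₁ − e₃ = 1` -/

/-- **Largest root.** If the cubic of a real lattice factors as `4(x − a)(x − b)(x − c)` with
`c < b < a`, then `e₁ = ℘(Ω₀/2) = a`: `e₁` is a root and `f > 0` on `(e₁, ∞)`, while
`f((a+b)/2) < 0`. [folklore] -/
theorem soloInformed_weierstrassPRe_half_eq_of_roots {L : PeriodPair} (h : L.IsReal)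
    {a b c : ℝ}
    (hf : ∀ x, 4 * x ^ 3 - L.g₂.re * x - L.g₃.re = 4 * ((x - a) * (x - b) * (x - c)))
    (hba : b < a) (hcb : c < b) : L.weierstrassPRe (L.minRealPeriod / 2) = a := by
  set e := L.weierstrassPRe (L.minRealPeriod / 2) with he
  have hroot : 4 * ((e - a) * (e - b) * (e - c)) = 0 := by
    rw [← hf]; exact h.cubic_weierstrassPRe_half
  have hmid : ¬ e < (a + b) / 2 := fun hlt ↦ by
    have hpos := h.cubic_pos_of_lt hlt
    rw [hf] at hpos
    have h1 : (a + b) / 2 - a < 0 := by linarith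
    have h2 : 0 < (a + b) / 2 - b := by linarith
    have h3 : 0 < (a + b) / 2 - c := by linarith
    nlinarith [mul_pos h2 h3]
  rcases mul_eq_zero.mp hroot with h0 | h0
  · norm_num at h0
  rcases mul_eq_zero.mp h0 with h0 | h0
  · rcases mul_eq_zero.mp h0 with h0 | h0
    · linarith
    · exact absurd (by linarith : e < (a + b) / 2) hmid
  · exact absurd (by linarith : e < (a + b) / 2) hmid

/-- **The substitution `x = c + s⁻²`.** For `c < b < a` with `a − c = 1`:
`∫_a^∞ dx/√(4(x−a)(x−b)(x−c)) = ∫₀¹ ds/√((1−s²)(1−(b−c)s²))` — the complete elliptic integral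
of the first kind of modulus `k² = b − c` (Lawden § 6.11; Whittaker–Watson § 22.42). [folklore] -/
theorem soloInformed_integral_Ioi_inv_sqrt_cubic_roots {a b c : ℝ} (hba : b < a) (hcb : c < b)
    (hac : a - c = 1) :
    ∫ x in Ioi a, (√(4 * ((x - a) * (x - b) * (x - c))))⁻¹ =
      ∫ s in Ioo (0:ℝ) 1, (√(1 - s ^ 2))⁻¹ * (√(1 - (b - c) * s ^ 2))⁻¹ := by
  set m := b - c with hm
  have hm0 : 0 < m := by rw [hm]; linarith
  have hm1 : m < 1 := by rw [hm]; linarith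
  have ha' : a = c + 1 := by linarith
  have hb' : b = c + m := by rw [hm]; ring
  set φ : ℝ → ℝ := fun s => c + (s ^ 2)⁻¹ with hφ
  have hder : ∀ s ∈ Ioo (0:ℝ) 1,
      HasDerivWithinAt φ (-(2 * s) / (s ^ 2) ^ 2) (Ioo (0:ℝ) 1) s := by
    intro s hs
    exact (((soloInformed_hasDerivAt_sq s).inv (pow_ne_zero 2 hs.1.ne')).const_add c)
      |>.hasDerivWithinAt
  have hinj : InjOn φ (Ioo (0:ℝ) 1) := by
    intro s hs t ht hst
    have h1 : (s ^ 2)⁻¹ = (t ^ 2)⁻¹ := by simpa [hφ] using hst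
    exact (pow_left_inj₀ hs.1.le ht.1.le two_ne_zero).mp (inv_inj.mp h1)
  have himg : φ '' Ioo (0:ℝ) 1 = Ioi a := by
    ext y
    constructor
    · rintro ⟨s, hs, rfl⟩
      rw [mem_Ioi]
      have hs2 : s ^ 2 < 1 := by nlinarith [hs.1, hs.2]
      have : 1 < (s ^ 2)⁻¹ := (one_lt_inv₀ (pow_pos hs.1 2)).mpr hs2
      show a < c + (s ^ 2)⁻¹
      linarith
    · intro hy
      rw [mem_Ioi] at hy
      have hyc : 0 < y - c := by linarith
      have hsq : 1 < √(y - c) := by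
        rw [show (1:ℝ) = √1 from Real.sqrt_one.symm]
        exact Real.sqrt_lt_sqrt (by norm_num) (by linarith)
      refine ⟨(√(y - c))⁻¹, ⟨inv_pos.mpr (by linarith), inv_lt_one_of_one_lt₀ hsq⟩, ?_⟩
      show c + (((√(y - c))⁻¹) ^ 2)⁻¹ = y
      rw [inv_pow, inv_inv, Real.sq_sqrt hyc.le]
      ring
  rw [← himg, integral_image_eq_integral_abs_deriv_smul measurableSet_Ioo hder hinj]
  refine setIntegral_congr_fun measurableSet_Ioo fun s hs ↦ ?_
  have hs0 : 0 < s := hs.1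
  have hs1 : s ^ 2 < 1 := by nlinarith [hs.1, hs.2]
  have h1s : 0 < 1 - s ^ 2 := by linarith
  have hms : 0 < 1 - m * s ^ 2 := by nlinarith
  have hprod : 4 * ((φ s - a) * (φ s - b) * (φ s - c)) =
      (2 / s ^ 3) ^ 2 * ((1 - s ^ 2) * (1 - m * s ^ 2)) := by
    simp only [hφ, ha', hb']
    field_simp
    ring
  have hneg : -(2 * s) / (s ^ 2) ^ 2 < 0 := div_neg_of_neg_of_pos (by linarith) (by positivity)
  rw [smul_eq_mul, hprod, Real.sqrt_mul (sq_nonneg _), Real.sqrt_sq (by positivity),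
    Real.sqrt_mul h1s.le, abs_of_neg hneg]
  have hr1 : √(1 - s ^ 2) ≠ 0 := (Real.sqrt_pos.mpr h1s).ne'
  have hr2 : √(1 - m * s ^ 2) ≠ 0 := (Real.sqrt_pos.mpr hms).ne'
  field_simp

/-- **Real-period formula in Legendre form.** For a real lattice whose cubic is
`4(x − a)(x − b)(x − c)`, `c < b < a`, `a − c = 1`:  `Ω₀/2 = K(k)` with `k² = b − c`, i.e.
`Ω₀/2 = ∫₀¹ ds/√((1−s²)(1−(b−c)s²))` (Lawden (6.11.11); Whittaker–Watson § 22.42). [folklore] -/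
theorem soloInformed_minRealPeriod_div_two_eq_of_roots {L : PeriodPair} (h : L.IsReal)
    {a b c : ℝ}
    (hf : ∀ x, 4 * x ^ 3 - L.g₂.re * x - L.g₃.re = 4 * ((x - a) * (x - b) * (x - c)))
    (hba : b < a) (hcb : c < b) (hac : a - c = 1) :
    L.minRealPeriod / 2 = ∫ s in Ioo (0:ℝ) 1, (√(1 - s ^ 2))⁻¹ * (√(1 - (b - c) * s ^ 2))⁻¹ := by
  rw [← h.integral_Ioi_inv_sqrt_cubic_eq, soloInformed_weierstrassPRe_half_eq_of_roots h hf hba hcb,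
    ← soloInformed_integral_Ioi_inv_sqrt_cubic_roots hba hcb hac]
  exact setIntegral_congr_fun measurableSet_Ioi fun x _ ↦ by rw [hf]

end Summit.KontsevichZagierPeriods.KontsevichZagierPeriods.Theorems

end
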